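import Mathlib
import Summits.MatrixMultiplication.MatrixMultiplication.Theorems.LevelGradedCohnUmansLevelOneGL2DesignsStubTangencySetsProjectiveChart

/-!
# Stub `stub_tangencySets` (crux `LevelOneGL2Designs`, stmt-MatrixMultiplication-14080) —
wall-breaker axis 1/12 "Hermitian unital constructions" (gen 1, seat 2), part C: the rank-three
normal form of the wall, and the Hermitian slice inside it

A design `S` in the stub's format has the `|S| × |S|` *incidence defect matrix*
`E_{f f'} = x_f ⬝ y_{f'} − 1 = (x_f, 1) ⬝ (y_{f'}, −1)`: zero diagonal, nowhere-zero off the diagonal,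
rank `≤ 3`.  Conversely ANY square matrix over a field with these three properties is, after a rank
factorisation `E = A·B` through `F³`, a strong representative system of `PG(2,F)` (rows = lines,
columns = points), hence — by the affine chart of `…ProjectiveChart.lean` — a design in the stub's
format with at most two flags lost.  So the whole wall has the normal form

  `T(p) + O(1) = max { n : ∃ E ∈ M_n(𝔽_p), rank E ≤ 3, E_ii = 0, E_ij ≠ 0 (i ≠ j) }`

(`srs_defect_rank_le_three`, `srs_of_rank_le_three`, `stub_tangencySets_iff_rankThree`), and the
"Hermitian unital constructions" of this axis are precisely the SELF-ADJOINT slice `Eᵀ = σ(E)`: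
over `𝔽_{q²}` with `σ` = Frobenius the unital realises `n = q³ + 1`; over `ZMod p` (`σ = id`) the
slice is `E` symmetric, capped at `n ≤ p + 1` by part A (`polarity_isotropic_card_le`).  Over an
ORDERED field `E_ij = (x_i − x_j)²` shows `n = ∞` already in the symmetric slice — the finite-field
content of the wall is exactly the absence of positivity.

Ingredients: Mathlib's `Matrix.exists_rank_normal_form` (rank factorisation through `Fin (rank E)`,
padded to `Fin 3`) and `TangencyRandAlg.stub_srs_of_projective_srs` (tree).  No new definitions.
-/

set_option linter.dupNamespace false

namespace Summit.MatrixMultiplication.MatrixMultiplication.Theorems.LevelOneGL2Designs.HermitianUnital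

open Finset Matrix

section Factorisation

variable {F : Type*} [Field F]

/-- Zero-padding `Fin r → F` into `Fin 3 → F` (`r ≤ 3`) preserves dot products. [folklore] -/
theorem pad_dotProduct_pad {r : ℕ} (hr : r ≤ 3) (a b : Fin r → F) :
    (fun t : Fin 3 => if h : (t : ℕ) < r then a ⟨t, h⟩ else 0) ⬝ᵥ
      (fun t : Fin 3 => if h : (t : ℕ) < r then b ⟨t, h⟩ else 0) = a ⬝ᵥ b := by
  let g : ℕ → F := fun s => if h : s < r then a ⟨s, h⟩ * b ⟨s, h⟩ else 0
  have hL : ∀ t : Fin 3, (if h : (t : ℕ) < r then a ⟨t, h⟩ else 0) *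
      (if h : (t : ℕ) < r then b ⟨t, h⟩ else 0) = g t := by
    intro t
    simp only [g]
    split_ifs <;> simp
  have hR : ∀ s : Fin r, a s * b s = g s := by
    intro s
    simp only [g, dif_pos s.2]
  simp only [dotProduct, hL, hR]
  rw [Fin.sum_univ_eq_sum_range g 3, Fin.sum_univ_eq_sum_range g r]
  refine (sum_subset (range_subset_range.2 hr) ?_).symm
  intro s _ hs
  simp only [mem_range, not_lt] at hs
  simp only [g, dif_neg (not_lt.2 hs)]

/-- **Rank factorisation through `F³`.**  A square matrix of rank `≤ 3` over a field is a matrix of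
dot products `E i j = L i ⬝ P j` of vectors in `F³` (from Mathlib's rank normal form
`V E U = [[1,0],[0,0]]`, padded with zeros when `rank E < 3`). [folklore] -/
theorem exists_dotProduct_eq_of_rank_le_three {ι : Type*} [Fintype ι] [DecidableEq ι]
    (E : Matrix ι ι F) (hE : E.rank ≤ 3) :
    ∃ L P : ι → Fin 3 → F, ∀ i j, L i ⬝ᵥ P j = E i j := by
  classical
  obtain ⟨V, U, e, hV, hU, hVEU⟩ := exists_rank_normal_form E
  have hVd : IsUnit V.det := (isUnit_iff_isUnit_det V).mp hV
  have hUd : IsUnit U.det := (isUnit_iff_isUnit_det U).mp hU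
  -- the normal form factors through `Fin (rank E)`
  let Rr : Matrix (Fin E.rank ⊕ Fin (Fintype.card ι - E.rank)) (Fin E.rank) F := fromRows 1 0
  let Cr : Matrix (Fin E.rank) (Fin E.rank ⊕ Fin (Fintype.card ι - E.rank)) F := fromCols 1 0
  have hRC : Rr * Cr = fromBlocks 1 0 0 0 := by
    simp only [Rr, Cr, fromRows_mul_fromCols, Matrix.mul_one, Matrix.mul_zero]
  let A : Matrix ι (Fin E.rank) F := V⁻¹ * Rr.submatrix e id
  let B : Matrix (Fin E.rank) ι F := Cr.submatrix id e * U⁻¹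
  have hAB : A * B = E := by
    have h1 : Rr.submatrix e id * Cr.submatrix id e = (fromBlocks 1 0 0 0).submatrix e e := by
      rw [← hRC, submatrix_mul _ _ e id e Function.bijective_id]
    calc A * B = V⁻¹ * (Rr.submatrix e id * Cr.submatrix id e) * U⁻¹ := by
          simp only [A, B, Matrix.mul_assoc]
      _ = V⁻¹ * (V * E * U) * U⁻¹ := by rw [h1, hVEU]
      _ = (V⁻¹ * V) * E * (U * U⁻¹) := by simp only [Matrix.mul_assoc]
      _ = E := by rw [nonsing_inv_mul V hVd, mul_nonsing_inv U hUd, Matrix.one_mul, Matrix.mul_one]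
  refine ⟨fun i t => if h : (t : ℕ) < E.rank then A i ⟨t, h⟩ else 0,
    fun j t => if h : (t : ℕ) < E.rank then B ⟨t, h⟩ j else 0, fun i j => ?_⟩
  have hij : (A * B) i j = E i j := by rw [hAB]
  rw [pad_dotProduct_pad hE (fun s => A i s) (fun s => B s j), ← hij, Matrix.mul_apply]
  rfl

end Factorisation

section NormalForm

variable {F : Type*} [Field F]

/-- **Defect matrix of a design.**  For `S` in the stub's format the matrix
`E_{f f'} = x_f ⬝ y_{f'} − 1` on `S × S` has zero diagonal, nowhere-zero off-diagonal, and rank `≤ 3`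
(it is `(x_f, 1) ⬝ (y_{f'}, −1)`).  [elementary] -/
theorem srs_defect_rank_le_three (S : Finset ((Fin 2 → F) × (Fin 2 → F)))
    (hS : ∀ f ∈ S, ∀ f' ∈ S, (f.1 ⬝ᵥ f'.2 = 1 ↔ f = f')) :
    (∀ f : S, (Matrix.of fun f f' : S => f.1.1 ⬝ᵥ f'.1.2 - 1) f f = 0) ∧
    (∀ f f' : S, f ≠ f' → (Matrix.of fun f f' : S => f.1.1 ⬝ᵥ f'.1.2 - 1) f f' ≠ 0) ∧
    (Matrix.of fun f f' : S => f.1.1 ⬝ᵥ f'.1.2 - 1).rank ≤ 3 := by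
  classical
  refine ⟨fun f => ?_, fun f f' hne h => ?_, ?_⟩
  · simp only [of_apply, sub_eq_zero]
    exact (hS _ f.2 _ f.2).mpr rfl
  · simp only [of_apply, sub_eq_zero] at h
    exact hne (Subtype.ext ((hS _ f.2 _ f'.2).mp h))
  · -- `E = A * B` with `A : S × Fin 3`, `B : Fin 3 × S`
    let A : Matrix S (Fin 3) F := Matrix.of fun f t => ![f.1.1 0, f.1.1 1, 1] t
    let B : Matrix (Fin 3) S F := Matrix.of fun t f' => ![f'.1.2 0, f'.1.2 1, -1] t
    have hAB : (Matrix.of fun f f' : S => f.1.1 ⬝ᵥ f'.1.2 - 1) = A * B := by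
      ext f f'
      simp only [of_apply, Matrix.mul_apply, A, B, Fin.sum_univ_three, vec2_dotProduct,
        cons_val_zero, cons_val_one]
      simp
      ring
    rw [hAB]
    exact (rank_mul_le_left A B).trans (rank_le_card_width A |>.trans (by simp))

/-- **From a rank-three matrix to a design.**  Any square matrix over a finite field with zero
diagonal, nowhere-zero off-diagonal and rank `≤ 3` yields a design in the stub's format with at most
two flags fewer than the matrix has rows (rank factorisation = an SRS of `PG(2,F)`, then the affine
chart of `stub_srs_of_projective_srs`).  [this file + tree] -/
theorem srs_of_rank_le_three [Fintype F] [DecidableEq F] {ι : Type*} [Fintype ι] [DecidableEq ι]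
    (E : Matrix ι ι F)
    (h0 : ∀ i, E i i = 0) (h1 : ∀ i j, i ≠ j → E i j ≠ 0) (hE : E.rank ≤ 3) :
    ∃ S : Finset ((Fin 2 → F) × (Fin 2 → F)), Fintype.card ι ≤ S.card + 2 ∧
      ∀ f ∈ S, ∀ f' ∈ S, (f.1 ⬝ᵥ f'.2 = 1 ↔ f = f') := by
  obtain ⟨L, P, hLP⟩ := exists_dotProduct_eq_of_rank_le_three E hE
  refine ProjectiveChart.stub_srs_of_projective_srs P L fun i j => ?_
  rw [hLP]
  constructor
  · intro h
    by_contra hne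
    exact h1 i j hne h
  · rintro rfl
    exact h0 i

end NormalForm

section Stub

/-- `p^{3/2}` bookkeeping: for `p ≥ 16/c²` we have `2 ≤ (c/2)·p^{3/2}`. [elementary] -/
theorem two_le_half_mul_rpow {c : ℝ} (hc : 0 < c) {p : ℕ} (hp : 16 / c ^ 2 ≤ p) :
    (2 : ℝ) ≤ c / 2 * (p : ℝ) ^ (3 / 2 : ℝ) := by
  have hp0 : (0 : ℝ) ≤ p := by positivity
  have hc2 : (0 : ℝ) < c ^ 2 := by positivity
  have h16 : 16 ≤ c ^ 2 * p := by
    rw [div_le_iff₀ hc2] at hp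
    linarith
  have hp1 : (1 : ℝ) ≤ p := by
    have hpos : (0 : ℝ) < 16 / c ^ 2 := by positivity
    have hp' : 0 < p := by exact_mod_cast hpos.trans_le hp
    exact_mod_cast hp'
  -- `p ≤ p^{3/2}` and `4 ≤ c √p`-free route: `c p^{3/2} ≥ c p · 1` and `(c p)² ≥ 16 p ≥ 16`
  have h32 : (p : ℝ) ≤ (p : ℝ) ^ (3 / 2 : ℝ) := by
    calc (p : ℝ) = (p : ℝ) ^ (1 : ℝ) := (Real.rpow_one _).symm
      _ ≤ (p : ℝ) ^ (3 / 2 : ℝ) := Real.rpow_le_rpow_of_exponent_le hp1 (by norm_num)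
  have hsq : (p : ℝ) ^ (3 / 2 : ℝ) * (p : ℝ) ^ (3 / 2 : ℝ) = (p : ℝ) ^ 3 := by
    rw [← Real.rpow_add_of_nonneg hp0 (by norm_num) (by norm_num)]
    norm_num
  -- `(c/2 · p^{3/2})² = c²p³/4 ≥ c² p · p² /4 ≥ 4 p² ≥ 4`, and both sides nonnegative
  have hx0 : 0 ≤ c / 2 * (p : ℝ) ^ (3 / 2 : ℝ) := by positivity
  nlinarith [hsq, h16, hp1, hx0, sq_nonneg ((p : ℝ) ^ (3 / 2 : ℝ)), mul_nonneg hp0 hp0]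

/-- **The wall in rank-three normal form.**  `stub_tangencySets` holds iff for some `c > 0` and
unboundedly many primes `p` there is a square matrix over `ZMod p` with at least `c·p^{3/2}` rows, zero
diagonal, nowhere-zero off-diagonal and rank `≤ 3`.  (The Hermitian axis is its self-adjoint slice
`Eᵀ = σ(E)`: `q³ + 1` over `𝔽_{q²}`, `≤ p + 1` over `ZMod p` by part A.)  [this file] -/
theorem stub_tangencySets_iff_rankThree :
    (∃ c : ℝ, 0 < c ∧ ∀ p₀ : ℕ, ∃ (p : ℕ) (_ : Fact p.Prime), p₀ ≤ p ∧
      ∃ S : Finset ((Fin 2 → ZMod p) × (Fin 2 → ZMod p)),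
        c * (p : ℝ) ^ (3 / 2 : ℝ) ≤ S.card ∧
        ∀ f ∈ S, ∀ f' ∈ S, (dotProduct f.1 f'.2 = 1 ↔ f = f')) ↔
    (∃ c : ℝ, 0 < c ∧ ∀ p₀ : ℕ, ∃ (p : ℕ) (_ : Fact p.Prime), p₀ ≤ p ∧
      ∃ (n : ℕ) (E : Matrix (Fin n) (Fin n) (ZMod p)),
        c * (p : ℝ) ^ (3 / 2 : ℝ) ≤ n ∧ (∀ i, E i i = 0) ∧ (∀ i j, i ≠ j → E i j ≠ 0) ∧
        E.rank ≤ 3) := by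
  classical
  constructor
  · rintro ⟨c, hc, hfam⟩
    refine ⟨c, hc, fun p₀ => ?_⟩
    obtain ⟨p, hp, hp₀, S, hbig, hS⟩ := hfam p₀
    obtain ⟨h0, h1, hr⟩ := srs_defect_rank_le_three S hS
    -- reindex `S ≃ Fin |S|`
    let e : Fin S.card ≃ S := (S.equivFin).symm
    refine ⟨p, hp, hp₀, S.card, Matrix.of fun i j => (e i).1.1 ⬝ᵥ (e j).1.2 - 1, by simpa using hbig,
      fun i => h0 (e i), fun i j hij => h1 (e i) (e j) (fun h => hij (e.injective h)), ?_⟩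
    have : (Matrix.of fun i j : Fin S.card => (e i).1.1 ⬝ᵥ (e j).1.2 - 1) =
        (Matrix.of fun f f' : S => f.1.1 ⬝ᵥ f'.1.2 - 1).submatrix e e := by
      ext i j; rfl
    rw [this, rank_submatrix _ e e]
    exact hr
  · rintro ⟨c, hc, hfam⟩
    refine ⟨c / 2, by positivity, fun p₀ => ?_⟩
    obtain ⟨p, hp, hp₀, n, E, hbig, h0, h1, hr⟩ := hfam (max p₀ ⌈16 / c ^ 2⌉₊)
    obtain ⟨S, hcard, hS⟩ := srs_of_rank_le_three E h0 h1 hr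
    refine ⟨p, hp, le_trans (le_max_left _ _) hp₀, S, ?_, hS⟩
    have hp16 : 16 / c ^ 2 ≤ p := le_trans (Nat.le_ceil _) (by exact_mod_cast le_trans (le_max_right _ _) hp₀)
    have h2 := two_le_half_mul_rpow hc hp16
    have hcard' : (n : ℝ) ≤ S.card + 2 := by
      rw [Fintype.card_fin] at hcard
      exact_mod_cast hcard
    linarith

end Stub

end Summit.MatrixMultiplication.MatrixMultiplication.Theorems.LevelOneGL2Designs.HermitianUnital
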